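import Summits.HubbardSuperconductivity.HubbardSuperconductivity.Theses.PlaquetteBoson
import Summits.HubbardSuperconductivity.HubbardSuperconductivity.Theorems.TwTipContinuation.Negative.TipNormalForm
import Summits.HubbardSuperconductivity.HubbardSuperconductivity.Theorems.PbContinuation.Negative.NormalForm
import Literature.Barriers.HubbardSuperconductivity.PureModelStripeCompetition
import HarnessLib

/-!
# Crux `PbContinuation` (stmt-HubbardSuperconductivity-0907) — STRATEGY-CENSUS r1 sketch
# (crux-strategist REDIRECT r1, second independent census, 2026-08-17)

Sorry-free companion of `STRATEGY-CENSUS-r1.md` (planner `cstrat-stmt-HubbardSuperconductivity-0907-r1`).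
It does NOT restate the crux, is NOT a line, and files nothing. Over the LITERAL route terms it records:

* §1 SUMMIT STRENGTH, POINTWISE — the theorems the tribunal asked for:
  `summitAt_of_pbContinuation` (at every admissible point where the anchor is lit, the crux instance IS the
  summit matrix there), `summit_of_pbContinuation_of_anchorAt` (so crux + one lit anchor = a summit witness;
  with `PbAnchorOrder` this is the route's `closes`), `pbContinuation_iff_summitAt_on_anchorSet` (the crux is
  EXACTLY "the summit matrix at every lit point", nothing weaker), and the T1(a)-shaped dominating hypothesis
  `UniformSummit ⇒ crux`, `UniformSummit ⇒ summit` (`UniformSummit` is itself refuted by the catalogued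
  stripe conjecture: `not_uniformSummit_of_stripes`).
* §2 NOT ON THE PATH TO S — `summit_and_not_pbContinuation`: one lit-and-dark admissible point (the vacancy
  corner) together with one lit summit point gives `S ∧ ¬ crux`; so `S → crux` is not to be expected and the
  crux is logically SKEW to the summit (pointwise ≥ S on the anchor set, expected-false off the B₁g window).
* §3 DECOMPOSITION attempts of this census (new w.r.t. census s2 D1–D6): D10 truth-table split along a window
  (`pbContinuation_iff_on_and_compl`, assembly `pbContinuation_of_subs` PROVED; the complement piece contains
  the corner: `not_on_compl_W₀_of_corner`), D11 channel split through the catalogued `dxyFormFactor`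
  (`pbContinuation_of_channelSubs` PROVED; the false content moves into `ChannelUpgrade`:
  `not_channelUpgrade_of_corner`).
* §4 STRENGTHEN attempts (new): S⁺₄ `OrderLipschitz` (quantitative decay-rate transport; its `t' = 1`
  instance is already endpoint order — costume: `eventualOrder_one_of_orderLipschitz` — and, implying the
  crux at `(U,δ)`, it is corner-false), S⁺₅ `TUniformAnchorContinuation` (`t'`-uniform anchor constant;
  weaker on the hypothesis side, still corner-false: `not_tUniformAnchorContinuation_of_corner`).
* §5 TRANSFER / NEGATION typed shapes: the two open halves of the corner as the weakest statements the
  transferred tools would have to deliver — `DiluteAnchor` (N1: dilute plaquette-pair BEC, sibling = ALSSY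
  2004 half-filled hard-core lattice BEC; LSSY 2005 p.117: "no one has so far found a way to prove
  condensation" off half filling) and `NoB1gOrderWeakCoupling` (N2: channel selection at `T = 0`, sibling =
  BGM 2006 2D-Hubbard Fermi liquid, valid only for `T ≥ e^{-a/U}`, Mastropietro 2008 Thm 14.1 / p.231) —
  and `not_pbContinuation_of_N1_N2` (N1 ∧ N2 ⇒ ¬ crux), the formal content of "expected-false".

Every constant is an existing declaration; no new Literature definition. [folklore]
-/

noncomputable section

-- `dupNamespace`: the summit and the problem are both named `HubbardSuperconductivity` (layout D-0022)
set_option linter.dupNamespace false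

namespace Summit.HubbardSuperconductivity.HubbardSuperconductivity.Cruxes.PbContinuation.CensusR1

open Matrix Filter
open Literature.Probability.LatticeModels Literature.MathematicalPhysics.QuantumLattice
open Summit.HubbardSuperconductivity.HubbardSuperconductivity.Theses.PlaquetteBoson
  (PbContinuation PbAnchorOrder)
open Summit.HubbardSuperconductivity.TwTipContinuation.Negative (summitMatrix_iff_everyGSOrder)
open Literature.Barriers.HubbardSuperconductivity (HasDWavePairFieldLROAt PureModelStripeCompetition)

/-! ## §0 The objects of the crux, named (verbatim copies of the route terms) -/

/-- The checkerboard torus `H_L(a, b, U)`: intra-plaquette hopping `a`, inter-plaquette hopping `b`,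
on-site `U` on the plaquette bonds' Hamiltonian only (as in the crux). [folklore] -/
def checker (L : ℕ) [NeZero L] (a b U : ℝ) :=
  hamiltonian ((fermionTorusGraph 2 L) \ SimpleGraph.comap
      (fun x : FermionTorus 2 L => fun i : Fin 2 => ((ofLex x) i : ℕ) / 2) ⊤) a U +
    hamiltonian ((fermionTorusGraph 2 L) ⊓ SimpleGraph.comap
      (fun x : FermionTorus 2 L => fun i : Fin 2 => ((ofLex x) i : ℕ) / 2) ⊤) b 0

/-- Every-GS `d_{x²-y²}` pair-field order bound `c·L⁴` of `checker L 1 t' U` in the sector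
`(2⌊(1-δ)L²/2⌋, S^z = 0)`, at ONE side `L` and ONE `t'`. [folklore] -/
def OrderAt (L : ℕ) [NeZero L] (t' U δ c : ℝ) : Prop :=
  ∀ (N : ℕ) (ψ : Fock (Orb (FermionTorus 2 L))),
    N = 2 * ⌊(1 - δ) * (L : ℝ) ^ 2 / 2⌋₊ → star ψ ⬝ᵥ ψ = 1 →
    IsGroundStateInSector (checker L 1 t' U) N 0 ψ →
    c * (L : ℝ) ^ 4 ≤ (expect ((pairField dWaveFormFactor L)ᴴ * pairField dWaveFormFactor L) ψ).re

/-- The ANCHOR at `(U,δ)` (verbatim antecedent of the crux). [folklore] -/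
def AnchorAt (U δ : ℝ) : Prop :=
  ∃ t₀ : ℝ, 0 < t₀ ∧ ∀ t' ∈ Set.Ioo (0:ℝ) t₀, ∃ c : ℝ, 0 < c ∧ ∃ L₀ : ℕ, ∀ (L : ℕ) [NeZero L],
    L₀ ≤ L → 4 ∣ L → ∀ (N : ℕ) (ψ : Fock (Orb (FermionTorus 2 L))),
      N = 2 * ⌊(1 - δ) * (L : ℝ) ^ 2 / 2⌋₊ → star ψ ⬝ᵥ ψ = 1 →
      IsGroundStateInSector
        (hamiltonian ((fermionTorusGraph 2 L) \ SimpleGraph.comap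
            (fun x : FermionTorus 2 L => fun i : Fin 2 => ((ofLex x) i : ℕ) / 2) ⊤) 1 U +
          hamiltonian ((fermionTorusGraph 2 L) ⊓ SimpleGraph.comap
            (fun x : FermionTorus 2 L => fun i : Fin 2 => ((ofLex x) i : ℕ) / 2) ⊤) t' 0) N 0 ψ →
      c * (L : ℝ) ^ 4 ≤ (expect ((pairField dWaveFormFactor L)ᴴ * pairField dWaveFormFactor L) ψ).re

/-- The anchor is "small-`t'` `OrderAt`, eventually in `L ∈ 4ℕ`" (definitional). [folklore] -/
theorem anchorAt_iff (U δ : ℝ) :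
    AnchorAt U δ ↔ ∃ t₀ : ℝ, 0 < t₀ ∧ ∀ t' ∈ Set.Ioo (0:ℝ) t₀, ∃ c : ℝ, 0 < c ∧ ∃ L₀ : ℕ,
      ∀ (L : ℕ) [NeZero L], L₀ ≤ L → 4 ∣ L → OrderAt L t' U δ c :=
  Iff.rfl

/-- The SUMMIT MATRIX at `(U,δ)` (verbatim consequent of the crux) is the catalogued
`HasDWavePairFieldLROAt U δ`. [folklore] -/
abbrev SummitAt (U δ : ℝ) : Prop := HasDWavePairFieldLROAt U δ

/-- Admissible parameters of the summit. [folklore] -/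
def Admissible (U δ : ℝ) : Prop := 0 < U ∧ δ ∈ Set.Ioo (0:ℝ) (1/2)

/-- Pointwise normal form of the crux (definitional). [folklore] -/
theorem pbContinuation_iff :
    PbContinuation ↔ ∀ U δ : ℝ, 0 < U → δ ∈ Set.Ioo (0:ℝ) (1/2) → AnchorAt U δ → SummitAt U δ :=
  Iff.rfl

/-- `PbAnchorOrder` = "the anchor is lit SOMEWHERE admissible" (definitional). [folklore] -/
theorem pbAnchorOrder_iff :
    PbAnchorOrder ↔ ∃ U : ℝ, 0 < U ∧ ∃ δ ∈ Set.Ioo (0:ℝ) (1/2), AnchorAt U δ := Iff.rfl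

/-- The summit = "the summit matrix holds SOMEWHERE admissible" (definitional). [folklore] -/
theorem summit_iff :
    _root_.HubbardSuperconductivity ↔ ∃ U : ℝ, 0 < U ∧ ∃ δ ∈ Set.Ioo (0:ℝ) (1/2), SummitAt U δ :=
  Iff.rfl

/-! ## §1 Summit strength, pointwise (the theorems the tribunal asked for) -/

/-- **At every admissible point where the anchor is lit, the crux instance IS the summit matrix there.**
[folklore] -/
theorem summitAt_of_pbContinuation (hC : PbContinuation) {U δ : ℝ} (hU : 0 < U)
    (hδ : δ ∈ Set.Ioo (0:ℝ) (1/2)) (hA : AnchorAt U δ) : SummitAt U δ :=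
  hC U δ hU hδ hA

/-- **Crux + ONE lit admissible anchor = a summit witness** (the route's `closes`, with the anchor's
location made explicit). The crux therefore carries no reduction of the summit: restricted to the anchor
set it is the summit matrix itself, point by point. [folklore] -/
theorem summit_of_pbContinuation_of_anchorAt (hC : PbContinuation) {U δ : ℝ} (hU : 0 < U)
    (hδ : δ ∈ Set.Ioo (0:ℝ) (1/2)) (hA : AnchorAt U δ) : _root_.HubbardSuperconductivity :=
  ⟨U, hU, δ, hδ, hC U δ hU hδ hA⟩

-- Through the route item `PbAnchorOrder` this is literally the route's deciding theorem
-- `PlaquetteBoson.closes (hA : PbAnchorOrder) (hC : PbContinuation) : HubbardSuperconductivity` (not copied).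

/-- **The crux is EXACTLY the family of summit matrices over the lit admissible points** — nothing weaker,
nothing model-theoretic in between. [folklore] -/
theorem pbContinuation_iff_summitAt_on_anchorSet :
    PbContinuation ↔
      ∀ p ∈ {p : ℝ × ℝ | Admissible p.1 p.2 ∧ AnchorAt p.1 p.2}, SummitAt p.1 p.2 := by
  constructor
  · rintro h ⟨U, δ⟩ ⟨⟨hU, hδ⟩, hA⟩
    exact h U δ hU hδ hA
  · intro h U δ hU hδ hA
    exact h (U, δ) ⟨⟨hU, hδ⟩, hA⟩

/-- T1(a)-shaped dominating hypothesis: the summit matrix at EVERY admissible point. [folklore] -/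
def UniformSummit : Prop := ∀ U δ : ℝ, 0 < U → δ ∈ Set.Ioo (0:ℝ) (1/2) → SummitAt U δ

/-- `UniformSummit ⇒ crux` (the anchor is not even used). [folklore] -/
theorem pbContinuation_of_uniformSummit (h : UniformSummit) : PbContinuation :=
  fun U δ hU hδ _ => h U δ hU hδ

/-- `UniformSummit ⇒ summit` (at `(1, 1/4)`, say). [folklore] -/
theorem summit_of_uniformSummit (h : UniformSummit) : _root_.HubbardSuperconductivity :=
  ⟨1, one_pos, 1/4, ⟨by norm_num, by norm_num⟩, h 1 (1/4) one_pos ⟨by norm_num, by norm_num⟩⟩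

/-- …but `UniformSummit` is refuted by the catalogued OPEN stripe conjecture (`(U,δ) = (8, 1/8)`), and is
expected-false at the vacancy corner anyway: the domination is by an unbelievable hypothesis. [folklore] -/
theorem not_uniformSummit_of_stripes (hS : PureModelStripeCompetition) : ¬ UniformSummit :=
  fun h => hS (h 8 (1/8) (by norm_num) ⟨by norm_num, by norm_num⟩)

/-- The only other anchor-free way to the crux: the anchor fails EVERYWHERE (vacuity) — which kills every
thesis `PbAnchorOrder ∧ PbContinuation` through its first conjunct. [folklore] -/
theorem pbContinuation_of_forall_not_anchor
    (h : ∀ U δ : ℝ, 0 < U → δ ∈ Set.Ioo (0:ℝ) (1/2) → ¬ AnchorAt U δ) : PbContinuation :=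
  fun U δ hU hδ hA => (h U δ hU hδ hA).elim

/-- …and then the route is dead: vacuous crux ⇒ `¬ PbAnchorOrder`. [folklore] -/
theorem not_pbAnchorOrder_of_forall_not_anchor
    (h : ∀ U δ : ℝ, 0 < U → δ ∈ Set.Ioo (0:ℝ) (1/2) → ¬ AnchorAt U δ) : ¬ PbAnchorOrder := by
  rintro ⟨U, hU, δ, hδ, hA⟩
  exact h U δ hU hδ hA

/-! ## §2 Not on the path to S -/

/-- **`S ∧ ¬ crux` from one lit-and-dark admissible point plus one lit summit point.** The census's
expected instance: `(U₁,δ₁)` in the vacancy corner (`U₁ < 4`, `δ₁ ∈ (2/5,1/2)`: plaquette pair binding,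
dilute B₁g plaquette-pair condensate at small `t'`; pure torus `d_xy`/`p'`, Raghu–Kivelson–Scalapino 2010
p.7, Deng et al. 2015 pp.1–3) and `(U₂,δ₂)` wherever the summit is true (e.g. `(8,1/8)` is NOT such a point
if `PureModelStripeCompetition`; `U ∈ [2,4]`, `δ ≈ 0.2` is the route's bet). Hence `S → crux` is not to be
expected: the crux is not a consequence of the summit, and not weaker than it anywhere it has content.
[folklore] -/
theorem summit_and_not_pbContinuation {U₁ δ₁ U₂ δ₂ : ℝ} (h₁ : Admissible U₁ δ₁) (hA : AnchorAt U₁ δ₁)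
    (hD : ¬ SummitAt U₁ δ₁) (h₂ : Admissible U₂ δ₂) (hS : SummitAt U₂ δ₂) :
    _root_.HubbardSuperconductivity ∧ ¬ PbContinuation :=
  ⟨⟨U₂, h₂.1, δ₂, h₂.2, hS⟩, fun hC => hD (hC U₁ δ₁ h₁.1 h₁.2 hA)⟩

/-- Negation normal form (what a formal refutation must exhibit). [folklore] -/
theorem not_pbContinuation_iff :
    ¬ PbContinuation ↔ ∃ U δ : ℝ, Admissible U δ ∧ AnchorAt U δ ∧ ¬ SummitAt U δ := by
  constructor
  · intro h
    by_contra hne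
    exact h fun U δ hU hδ hA => by
      by_contra hD
      exact hne ⟨U, δ, ⟨hU, hδ⟩, hA, hD⟩
  · rintro ⟨U, δ, ⟨hU, hδ⟩, hA, hD⟩ hC
    exact hD (hC U δ hU hδ hA)

/-! ## §3 Decomposition attempts of this census -/

/-- Windowed crux (candidate retarget R3 of census s2; here a PIECE). [folklore] -/
def PbContinuationOn (W : Set (ℝ × ℝ)) : Prop :=
  ∀ U δ : ℝ, (U, δ) ∈ W → 0 < U → δ ∈ Set.Ioo (0:ℝ) (1/2) → AnchorAt U δ → SummitAt U δ

/-- **D10 — truth-table split along ANY window**: crux ↔ (crux on `W`) ∧ (crux on `Wᶜ`). [folklore] -/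
theorem pbContinuation_iff_on_and_compl (W : Set (ℝ × ℝ)) :
    PbContinuation ↔ PbContinuationOn W ∧ PbContinuationOn Wᶜ := by
  constructor
  · intro h
    exact ⟨fun U δ _ => h U δ, fun U δ _ => h U δ⟩
  · rintro ⟨hin, hout⟩ U δ hU hδ hA
    by_cases hm : (U, δ) ∈ W
    · exact hin U δ hm hU hδ hA
    · exact hout U δ hm hU hδ hA

/-- D10 assembly in `route edit --split` shape (PROVED; `k = 2`). [folklore] -/
theorem pbContinuation_of_subs (W : Set (ℝ × ℝ)) :
    PbContinuationOn W → PbContinuationOn Wᶜ → PbContinuation :=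
  fun hin hout => (pbContinuation_iff_on_and_compl W).2 ⟨hin, hout⟩

/-- The physics window of the route's bet: plaquette pair-binding couplings × B₁g-led dopings. [folklore] -/
def W₀ : Set (ℝ × ℝ) := Set.Icc (1:ℝ) 4 ×ˢ Set.Icc (1/10 : ℝ) (7/20)

/-- A vacancy-corner point, `(U,δ) = (1/2, 49/100)` (density `n = 0.51`, deep in the weak-coupling
`d_xy`/`p'` region), is admissible and lies in the complement piece. [folklore] -/
theorem corner_admissible_mem_compl :
    Admissible (1/2) (49/100) ∧ ((1/2 : ℝ), (49/100 : ℝ)) ∈ W₀ᶜ := by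
  refine ⟨⟨by norm_num, by norm_num, by norm_num⟩, ?_⟩
  simp only [W₀, Set.mem_compl_iff, Set.mem_prod, Set.mem_Icc, not_and_or, not_le]
  exact Or.inl (Or.inl (by norm_num))

/-- **The complement piece dies at the corner**: anchor lit and pure torus dark at `(1/2, 49/100)` refute
`PbContinuationOn W₀ᶜ` — so D10 isolates, but cannot remove, the expected-false content; the piece
`PbContinuationOn W₀` is the honest residue (= retarget R3). [folklore] -/
theorem not_on_compl_W₀_of_corner (hA : AnchorAt (1/2) (49/100)) (hD : ¬ SummitAt (1/2) (49/100)) :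
    ¬ PbContinuationOn W₀ᶜ := fun h =>
  hD (h (1/2) (49/100) corner_admissible_mem_compl.2 (by norm_num) ⟨by norm_num, by norm_num⟩ hA)

/-- `d_xy` (B₂g) pair-field LRO of every admissible ground-state sequence of the pure torus at `(U,δ)` —
the summit matrix with the catalogued `dxyFormFactor` in place of `dWaveFormFactor`. [folklore] -/
def DxyOrderAt (U δ : ℝ) : Prop :=
  ∀ (N : ℕ → ℕ) (ψ : ∀ L, Fock (Orb (FermionTorus 2 L))),
    (∀ L, Even L → N L = 2 * ⌊(1 - δ) * (L : ℝ) ^ 2 / 2⌋₊ ∧ star (ψ L) ⬝ᵥ ψ L = 1 ∧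
        IsGroundStateInSector (hubbardTorus 2 L 1 U) (N L) 0 (ψ L)) →
      HasLongRangeOrder (fun k => halfOpenBox 2 (2 * k))
        (fun k => torusPullback (pairFieldCorr dxyFormFactor ψ) (2 * k))

/-- D11 piece (a) — CHANNEL DICHOTOMY: a lit B₁g plaquette anchor forces SOME singlet `d`-channel order of
the pure torus. (Kohn–Luttinger direction; expected-false in the triplet `p'` sliver `U ≲ 0.08`,
`0.5 < n < 0.6`, Deng et al. 2015 p.2, and unproved everywhere.) [folklore] -/
def ChannelDichotomy : Prop :=
  ∀ U δ : ℝ, 0 < U → δ ∈ Set.Ioo (0:ℝ) (1/2) → AnchorAt U δ → SummitAt U δ ∨ DxyOrderAt U δ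

/-- D11 piece (b) — CHANNEL UPGRADE: `d_xy` order of the pure torus + B₁g plaquette anchor ⇒ B₁g order of
the pure torus. (This is where the corner's false content lands: at `U < 4`, `δ ∈ (2/5,1/2)` all three of
"anchor lit", "`d_xy` lit", "B₁g dark" are expected.) [folklore] -/
def ChannelUpgrade : Prop :=
  ∀ U δ : ℝ, 0 < U → δ ∈ Set.Ioo (0:ℝ) (1/2) → DxyOrderAt U δ → AnchorAt U δ → SummitAt U δ

/-- **D11 assembly** (PROVED; `k = 2`, new object `dxyFormFactor`). [folklore] -/
theorem pbContinuation_of_channelSubs (ha : ChannelDichotomy) (hb : ChannelUpgrade) : PbContinuation := by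
  intro U δ hU hδ hA
  rcases ha U δ hU hδ hA with h | h
  · exact h
  · exact hb U δ hU hδ h hA

/-- …and piece (b) dies at the corner exactly as the crux does. [folklore] -/
theorem not_channelUpgrade_of_corner {U δ : ℝ} (h : Admissible U δ) (hxy : DxyOrderAt U δ)
    (hA : AnchorAt U δ) (hD : ¬ SummitAt U δ) : ¬ ChannelUpgrade :=
  fun hb => hD (hb U δ h.1 h.2 hxy hA)

/-! ## §4 Strengthen attempts of this census -/

/-- Two-place crux. [folklore] -/
def PbContinuationAt (U δ : ℝ) : Prop := AnchorAt U δ → SummitAt U δ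

/-- Every-GS order of the checkerboard torus with ONE constant, eventually in `L ∈ 4ℕ`, at hopping `t'`.
[folklore] -/
def EventualOrder (t' U δ c : ℝ) : Prop :=
  ∃ L₀ : ℕ, ∀ (L : ℕ) [NeZero L], L₀ ≤ L → 4 ∣ L → OrderAt L t' U δ c

/-- S⁺₄ — ORDER-LIPSCHITZ TRANSPORT: from a lit point `t₁` the every-GS order constant decays at most
linearly along `[t₁, 1]` with a slope too small to exhaust it (`κ (1 - t₁) < c₁`). The shape a
commutator/Hellmann–Feynman bound `‖∂H/∂t'‖ ≤ 4L²` would give IF the order were a Lipschitz function of the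
energy — it is not (no gap; `LROForcesLowLyingStates`). [folklore] -/
def OrderLipschitz (U δ : ℝ) : Prop :=
  ∃ t₁ ∈ Set.Ioo (0:ℝ) 1, ∃ c₁ κ : ℝ, 0 < c₁ ∧ 0 ≤ κ ∧ κ * (1 - t₁) < c₁ ∧
    ∀ t' ∈ Set.Icc t₁ 1, EventualOrder t' U δ (c₁ - κ * (t' - t₁))

/-- **S⁺₄ is costume**: its `t' = 1` instance is already every-GS order of `checker L 1 1 U`, which is the
pure torus `hubbardTorus 2 L 1 U` by the landed edge-partition identity
(`CooperPairDMottWalk.hamiltonian_sdiff_add_inf`, not imported here), i.e. the conclusion in `4 ∣ L` form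
(the `Even L` upgrade is the registered `stub_evenSides`); and since S⁺₄ ⇒ crux-at-`(U,δ)`, it is at least as
false as the crux at the corner. [folklore] -/
theorem eventualOrder_one_of_orderLipschitz {U δ : ℝ} (h : OrderLipschitz U δ) :
    ∃ c : ℝ, 0 < c ∧ EventualOrder 1 U δ c := by
  obtain ⟨t₁, ht₁, c₁, κ, hc₁, hκ, hslope, hall⟩ := h
  refine ⟨c₁ - κ * (1 - t₁), by linarith, ?_⟩
  exact hall 1 ⟨le_of_lt ht₁.2, le_rfl⟩

/-- S⁺₅ — `t'`-UNIFORM ANCHOR continuation: weaken the crux on the hypothesis side by demanding ONE order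
constant for all small `t'` (the physically natural form of a BEC anchor: condensate fraction continuous in
`t'`). Still ∀ `(U,δ)`, still contains the corner (a dilute condensate has a `t'`-uniform constant on
compacta of `(0,t₀)` just as well) — so still expected-false; recorded because it is the form in which
`EndpointClosure`-type arguments (landed `exists_nhds_forall_groundState_order`, p157375) can even start.
[folklore] -/
def TUniformAnchorAt (U δ : ℝ) : Prop :=
  ∃ t₀ : ℝ, 0 < t₀ ∧ ∃ c : ℝ, 0 < c ∧ ∀ t' ∈ Set.Ioo (0:ℝ) t₀, EventualOrder t' U δ c

/-- `t'`-uniform anchor ⇒ anchor. [folklore] -/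
theorem anchorAt_of_tUniform {U δ : ℝ} (h : TUniformAnchorAt U δ) : AnchorAt U δ := by
  obtain ⟨t₀, ht₀, c, hc, hall⟩ := h
  exact ⟨t₀, ht₀, fun t' ht' => ⟨c, hc, hall t' ht'⟩⟩

/-- S⁺₅ as a crux variant: weaker than the crux (stronger hypothesis)… [folklore] -/
def TUniformAnchorContinuation : Prop :=
  ∀ U δ : ℝ, 0 < U → δ ∈ Set.Ioo (0:ℝ) (1/2) → TUniformAnchorAt U δ → SummitAt U δ

/-- …implied by the crux… [folklore] -/
theorem tUniformAnchorContinuation_of_pbContinuation (h : PbContinuation) : TUniformAnchorContinuation :=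
  fun U δ hU hδ hA => h U δ hU hδ (anchorAt_of_tUniform hA)

/-- …and dead at the same corner (with the `t'`-uniform anchor there). [folklore] -/
theorem not_tUniformAnchorContinuation_of_corner {U δ : ℝ} (h : Admissible U δ)
    (hA : TUniformAnchorAt U δ) (hD : ¬ SummitAt U δ) : ¬ TUniformAnchorContinuation :=
  fun hc => hD (hc U δ h.1 h.2 hA)

/-! ## §5 Transfer / Negation: the two open halves of the corner, typed -/

/-- **N1 — DILUTE ANCHOR** (lit half of the corner): for every coupling in the plaquette pair-binding
window `U ∈ (0,4)` (`Δ_p = 2E(3) - E(2) - E(4) > 0` for `0 < U < U_p ≈ 4.584`, Arovas–Berg–Kivelson–Raghu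
2022 pp.7–8) and every doping `δ ∈ (2/5, 1/2)` (pair-boson density `1 - 2δ < 1/5` per plaquette), the
small-`t'` checkerboard tori have every-GS B₁g pair order. Transferred tool that would have to deliver it:
thermodynamic-limit BEC of interacting lattice bosons — known ONLY at half filling with hard cores by
reflection positivity (ALSSY 2004; LSSY 2005 p.117). OPEN. [conjecture] -/
def DiluteAnchor : Prop :=
  ∀ U ∈ Set.Ioo (0:ℝ) 4, ∀ δ ∈ Set.Ioo (2/5 : ℝ) (1/2), AnchorAt U δ

/-- **N2 — NO B₁g ORDER AT WEAK COUPLING BELOW `n = 0.6`** (dark half of the corner): at every doping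
`δ ∈ (2/5,1/2)` the pure torus has, for all small enough `U`, an admissible ground-state sequence WITHOUT
`d_{x²-y²}` pair LRO (`d_xy` for `n < 0.6`, Raghu–Kivelson–Scalapino 2010 p.7; `p'`/`d_xy`, Deng et al.
2015 pp.1–2). Transferred tool that would have to deliver it: a `T = 0` construction of the weakly
repulsive 2D Hubbard ground state resolving the pairing channel — the rigorous 2D-Hubbard Fermi-liquid
construction stops at `T ≥ e^{-a/U}` precisely because of the Cooper channel (Benfatto–Giuliani–Mastropietro
2006; Mastropietro 2008 Thm 14.1, p.231: `T = 0` only for highly asymmetric dispersion, FKT). OPEN.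
[conjecture] -/
def NoB1gOrderWeakCoupling : Prop :=
  ∀ δ ∈ Set.Ioo (2/5 : ℝ) (1/2), ∃ U₀ ∈ Set.Ioo (0:ℝ) 4, ∀ U ∈ Set.Ioo (0:ℝ) U₀, ¬ SummitAt U δ

/-- **N1 ∧ N2 ⇒ ¬ crux** — the formal content of "expected-false at the vacancy corner": the two OPEN
halves, each the natural output of a transferred programme that does not reach it, refute the crux at
`(U₀/2, 9/20)`. Neither half is a usable stub toward `S`: N1 is an instance of the routes' own anchor at a
point where the pure model is dark, N2 is a pure-model no-go. [folklore] -/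
theorem not_pbContinuation_of_N1_N2 (h1 : DiluteAnchor) (h2 : NoB1gOrderWeakCoupling) : ¬ PbContinuation := by
  have hδ : (9/20 : ℝ) ∈ Set.Ioo (2/5 : ℝ) (1/2) := ⟨by norm_num, by norm_num⟩
  obtain ⟨U₀, hU₀, hdark⟩ := h2 (9/20) hδ
  have hU : U₀ / 2 ∈ Set.Ioo (0:ℝ) U₀ := ⟨by linarith [hU₀.1], by linarith [hU₀.1]⟩
  have hU4 : U₀ / 2 ∈ Set.Ioo (0:ℝ) 4 := ⟨hU.1, by linarith [hU₀.2]⟩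
  intro hC
  exact hdark (U₀ / 2) hU (hC (U₀ / 2) (9/20) hU.1 ⟨by norm_num, by norm_num⟩ (h1 (U₀ / 2) hU4 (9/20) hδ))

/-- The same two halves also kill every STRENGTHENING and the complement piece of every WINDOW split whose
window misses `(0,U₀) × (2/5,1/2)` — one lemma for the whole census: anything implying the crux inherits
`¬`. [folklore] -/
theorem not_of_imp_pbContinuation {S : Prop} (hS : S → PbContinuation) (h1 : DiluteAnchor)
    (h2 : NoB1gOrderWeakCoupling) : ¬ S :=
  fun hs => not_pbContinuation_of_N1_N2 h1 h2 (hS hs)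

/-! ## §6 Retarget (tenure action; recorded, not filed): the ∃-terminus forms are summit-implied -/

/-- R1 (census s2): anchor somewhere ⇒ summit somewhere. [folklore] -/
def PbContinuationE : Prop :=
  (∃ U : ℝ, 0 < U ∧ ∃ δ ∈ Set.Ioo (0:ℝ) (1/2), AnchorAt U δ) →
    ∃ U : ℝ, 0 < U ∧ ∃ δ ∈ Set.Ioo (0:ℝ) (1/2), SummitAt U δ

/-- R1 is summit-implied (no expected-false instance) and still closes the route. [folklore] -/
theorem pbContinuationE_of_summit (h : _root_.HubbardSuperconductivity) : PbContinuationE := fun _ => h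

/-- [folklore] -/
theorem closesE (hA : PbAnchorOrder) (hE : PbContinuationE) : _root_.HubbardSuperconductivity := hE hA

/-- R6 (this census) — CORNER-FREE RAY: the anchor anywhere on the segment `[1,2] × {1/4}` ⇒ the summit
matrix at SOME coupling `U₁ ∈ [U₀, 4]` at the same doping (free terminus inside the pair-binding window,
doping inside the B₁g window `0.6 < n`; cf. s2's R5 with terminus `[U₀, 2U₀]` from the two-tiling identity).
Not summit-implied, not corner-false; its only known attack is still the summit at `δ = 1/4`. [folklore] -/
def PbContinuationRay' : Prop :=
  ∀ U₀ ∈ Set.Icc (1:ℝ) 2, AnchorAt U₀ (1/4) → ∃ U₁ ∈ Set.Icc U₀ 4, SummitAt U₁ (1/4)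

/-- crux ⇒ R6 (terminus `U₁ = U₀`). [folklore] -/
theorem ray'_of_pbContinuation (h : PbContinuation) : PbContinuationRay' := fun U₀ hU₀ hA =>
  ⟨U₀, ⟨le_rfl, by linarith [hU₀.2]⟩, h U₀ (1/4) (by linarith [hU₀.1]) ⟨by norm_num, by norm_num⟩ hA⟩

/-- R6 closes the route once the anchor item is sharpened to land on the segment (as census s2 recommends
for `DressHalfFilled` / `PbAnchorOrder`). [folklore] -/
theorem closesRay' (hA : ∃ U₀ ∈ Set.Icc (1:ℝ) 2, AnchorAt U₀ (1/4)) (hR : PbContinuationRay') :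
    _root_.HubbardSuperconductivity := by
  obtain ⟨U₀, hU₀, hA⟩ := hA
  obtain ⟨U₁, hU₁, hS⟩ := hR U₀ hU₀ hA
  exact ⟨U₁, by linarith [hU₀.1, hU₁.1], 1/4, ⟨by norm_num, by norm_num⟩, hS⟩

end Summit.HubbardSuperconductivity.HubbardSuperconductivity.Cruxes.PbContinuation.CensusR1
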